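import Literature.Probability.RandomPlanarGeometry.HexSAWStripSurfaceWidthOne
import HarnessLib

/-!
# At its own threshold the width-one strip diverges exactly linearly: `B_{1,L}(x_c; y_1) = 2(L + 1)`

Topic `Literature/Probability/RandomPlanarGeometry` (continues `HexSAWStripSurfaceWidthOne.lean` — `HV.stripGFy_beta_one_eq :
B_{1,L}(x_c; y) = 2 Σ_{k=1}^{L+1} (x_c² y)^k`, `HV.stripYT_one : y_1 = 2 + √2 = x_c⁻²`).  Source: N. R. Beaton, M. Bousquet-Mélou,
J. de Gier, H. Duminil-Copin, A. J. Guttmann, *The critical fugacity for surface adsorption of self-avoiding walks on the honeycomb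
lattice is `1 + √2`*, Comm. Math. Phys. 326 (2014) 727–754, arXiv:1109.0358v5, §3.2, Corollary 8 (p. 12): "The series (in `y`)
`A_T(x_c, y)`, `B_T(x_c, y)` and `C_T(x_c, y)` have radius of convergence `y_T`" — in print rational series that diverge at the
radius (p. 12: "a rational function of `x` and `y`").  Secondary: N. R. Beaton, A. J. Guttmann, I. Jensen, J. Phys. A 45 (2012)
055208 = arXiv:1110.6695, §2 (p. 4, after eq. (4): the width-zero arch series "A_0(x, y) = 2x³y/(1 − x²y)", denominator printed
"1 − x²" sic — their width `0` is the lane's `T = 1`).  Edition 2 (docstring-only: lit-1 g16's AS-PRINTED token 23:23:05Z folded).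

## What is proved (namespace `Literature.Probability.RandomPlanarGeometry.SAW.HV`; standard axioms)

An explicit instance of the divergence AT the threshold: at `y = y_1 = 2 + √2` every term of the width-one bridge polynomial equals
`1` (`x_c² y_1 = 1`), so

* ★ **`stripGFy_beta_one_stripYT_one : B_{1,L}(x_c; y_1) = 2 (L + 1)`** for every `L` — EXACTLY LINEAR growth in the strip length;
* `stripGFy_beta_one_stripYT_one_div : B_{1,L}(x_c; y_1)/(L + 1) = 2`; `tendsto_stripGFy_beta_one_stripYT_one_atTop` (`→ +∞`);
  `not_bddAbove_stripGFy_beta_one_stripYT_one`; **`stripYT_one_not_mem_stripBddSet`** — `y_1 ∉ stripBddSet 1`: the supremum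
  defining `y_1` is not attained (the width-one case of the lane's «THRESHOLD-DIVERGENCE», here by explicit count).

Label: lane corollary, XS (an exact instance; the general strip diverges at its threshold at least like `√L` by the lane's rate file,
here the true order — linear — is visible).  Lane «pcv-sawmu», a-p2 g11, 2026-08-23.
-/

noncomputable section

open Finset Filter Topology

namespace Literature.Probability.RandomPlanarGeometry.SAW.HV

/-- `x_c² · y_1 = 1` (`y_1 = 2 + √2 = x_c⁻²`). [cite: BeatonBousquetMelouDeGierDuminilCopinGuttmann2014, §3.2 Corollary 8 (arXiv v5 p. 12); lane: `stripYT_one`] -/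
theorem hexCriticalFugacity_sq_mul_stripYT_one : hexCriticalFugacity ^ 2 * stripYT 1 = 1 := by
  rw [stripYT_one, hexCriticalFugacity_sq]

/-- ★ **`B_{1,L}(x_c; y_1) = 2 (L + 1)`**: at its own threshold the width-one bridge polynomial is the number of zig-zag bridges of
`S_{1,L}` (two of each length), i.e. it grows EXACTLY linearly in `L`.
[cite: BeatonBousquetMelouDeGierDuminilCopinGuttmann2014, §3.2 Corollary 8 (arXiv v5 p. 12: B_T(x_c; ·) has radius y_T) with the proof of Proposition 5 (p. 9: the zig-zag walks); lane: explicit width-one instance, not stated in print] -/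
theorem stripGFy_beta_one_stripYT_one (L : ℕ) : stripGFy 1 L (IsBetaDart 1) (stripYT 1) = 2 * ((L : ℝ) + 1) := by
  rw [stripGFy_beta_one_eq, hexCriticalFugacity_sq_mul_stripYT_one]
  simp

/-- `B_{1,L}(x_c; y_1)/(L + 1) = 2`. [cite: BeatonBousquetMelouDeGierDuminilCopinGuttmann2014, §3.2 Corollary 8 (arXiv v5 p. 12); lane] -/
theorem stripGFy_beta_one_stripYT_one_div (L : ℕ) : stripGFy 1 L (IsBetaDart 1) (stripYT 1) / ((L : ℝ) + 1) = 2 := by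
  rw [stripGFy_beta_one_stripYT_one, mul_div_assoc, div_self (by positivity), mul_one]

/-- `B_{1,L}(x_c; y_1) → +∞` as `L → ∞`. [cite: BeatonBousquetMelouDeGierDuminilCopinGuttmann2014, §3.2 Corollary 8 (arXiv v5 p. 12); lane] -/
theorem tendsto_stripGFy_beta_one_stripYT_one_atTop :
    Tendsto (fun L : ℕ => stripGFy 1 L (IsBetaDart 1) (stripYT 1)) atTop atTop := by
  simp_rw [stripGFy_beta_one_stripYT_one]
  exact (tendsto_natCast_atTop_atTop.atTop_add tendsto_const_nhds).const_mul_atTop two_pos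

/-- The width-one bridge class is unbounded at `y_1`. [cite: BeatonBousquetMelouDeGierDuminilCopinGuttmann2014, §3.2 Corollary 8 (arXiv v5 p. 12); lane] -/
theorem not_bddAbove_stripGFy_beta_one_stripYT_one :
    ¬ BddAbove (Set.range fun L : ℕ => stripGFy 1 L (IsBetaDart 1) (stripYT 1)) := by
  rintro ⟨K, hK⟩
  obtain ⟨L, hL⟩ := (tendsto_stripGFy_beta_one_stripYT_one_atTop.eventually_gt_atTop K).exists
  exact absurd (hK ⟨L, rfl⟩) (not_le.2 hL)

/-- **`y_1 ∉ stripBddSet 1`**: the supremum `y_1 = sup (stripBddSet 1)` is not attained — the width-one series diverges AT its radius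
(explicit count; the general-`T` statement is the lane's threshold-divergence file).
[cite: BeatonBousquetMelouDeGierDuminilCopinGuttmann2014, §3.2 Corollary 8 (arXiv v5 p. 12); lane] -/
theorem stripYT_one_not_mem_stripBddSet : stripYT 1 ∉ stripBddSet 1 := fun h =>
  not_bddAbove_stripGFy_beta_one_stripYT_one h.2

end Literature.Probability.RandomPlanarGeometry.SAW.HV
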